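import Summits.AnomalousDissipation.AnomalousDissipation.Theses.MirrorVariety
import Summits.AnomalousDissipation.AnomalousDissipation.Theorems.TaylorGreenLoudGalerkinStates.Negative.Anatomy
import Summits.AnomalousDissipation.AnomalousDissipation.Theorems.MirrorVarietyTaylorGreenLoudGalerkinStatesStubTgForceRegular

/-!
# Sketch — crux idea `half-turn-parity-forcing` (crux stmt-AnomalousDissipation-15060,
`MirrorVariety.TaylorGreenLogLoudStates`), ideator 1, round 1

First checkable statements of the line, typed over existing declarations:

* `TwistedDegreeForcesBrokenZeros` — the abstract finite-dimensional lever (Brouwer degree; TRUE in print,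
  not yet in tree: Mathlib has no degree theory, the tree has Brouwer's fixed point theorem only):
  a coercive C¹ self-map of a Euclidean space whose zeros inside a linear involution's fixed space are
  nondegenerate with signed Jacobian count ≠ 1 has a zero OUTSIDE the fixed space.
* `halfTurn`, `IsHSymm` — the half-turn `H : x ↦ (½ − x₀, x₁, ½ − x₂)` of the Taylor–Green cell (a proper
  rotation by π about the horizontal line `{x₀ = ¼, x₂ = ¼}`, a symmetry of `f_TG` exchanging the two
  counter-swirling layers `x₂ < ¼`, `x₂ > ¼`; the von Kármán `R_π`).
* `HBrokenSteadyStatesExist` — milestone M1 of the line (rigorous existence of NON-LAMINAR steady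
  Taylor–Green Galerkin states along `ν_j → 0⁺`: `K`-symmetric, `H`-broken).
* `HBrokenLogLoudStates` — the heart (the crux witnessed inside the `H`-broken class) and the one-line
  glue `crux_of_hBrokenLogLoud` (the line concludes the crux BY NAME).
-/

noncomputable section

set_option linter.dupNamespace false

open scoped InnerProductSpace Topology BigOperators
open MeasureTheory Filter
open Literature.Analysis.FunctionSpaces Literature.Analysis.FunctionSpaces.Torus
open Summit.AnomalousDissipation.AnomalousDissipation.Theorems.TaylorGreenLoudGalerkinStates.Negative
open Summit.AnomalousDissipation.AnomalousDissipation.Theorems.TaylorGreenLoudGalerkinStates (reflMat actVec IsKSymm)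

namespace Summit.AnomalousDissipation.AnomalousDissipation.Cruxes.TaylorGreenLogLoudStates.HalfTurnParity

/-! ## §1 The abstract lever: a ℤ₂-twisted degree count forces symmetry-broken zeros -/

/-- **Twisted degree forces broken zeros** (Brouwer degree; e.g. Krasnosel'skiĭ–Zabreĭko 1984 §§1–3,
Rabinowitz 1971 for the continuum version).  Let `F` be a `C¹` self-map of `ℝⁿ` which is COERCIVE
(`⟪F c, c⟫ > 0` outside a ball, so `deg(F, B_R, 0) = deg(id) = 1`) and `H` a linear involution.  If the zeros
of `F` lying in `Fix H` form a finite set `S` of NONDEGENERATE zeros whose signed Jacobian count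
`∑_{c ∈ S} sign det DF(c)` is different from `1`, then `F` has a zero OUTSIDE `Fix H`.
(For `H`-equivariant `F`, `DF(c)` at `c ∈ Fix H` is block-diagonal on the `±1`-eigenspaces of `H` and
`sign det DF(c) = sign det DF(c)|₊ · sign det DF(c)|₋`: the count changes exactly when an `H`-ODD real
eigenvalue crosses zero on a symmetric branch — a pitchfork.)  Not provable in tree today (no degree
theory in Mathlib); stated as the line's imported lever. -/
def TwistedDegreeForcesBrokenZeros : Prop :=
  ∀ (n : ℕ) (F : EuclideanSpace ℝ (Fin n) → EuclideanSpace ℝ (Fin n))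
    (H : EuclideanSpace ℝ (Fin n) →L[ℝ] EuclideanSpace ℝ (Fin n)) (S : Finset (EuclideanSpace ℝ (Fin n))),
    (∀ c, H (H c) = c) → ContDiff ℝ 1 F →
    (∃ R : ℝ, 0 < R ∧ ∀ c, R ≤ ‖c‖ → 0 < ⟪F c, c⟫_ℝ) →
    (∀ c, c ∈ S ↔ (F c = 0 ∧ H c = c)) →
    (∀ c ∈ S, (fderiv ℝ F c).det ≠ 0) →
    (∑ c ∈ S, Real.sign ((fderiv ℝ F c).det)) ≠ 1 →
    ∃ c, F c = 0 ∧ H c ≠ c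

/-! ## §2 The half-turn of the Taylor–Green cell -/

/-- The linear part `diag(−1, 1, −1)` of the half-turn (a proper rotation by `π` about the `x₁`-direction). -/
def halfTurnMat : Matrix (Fin 3) (Fin 3) ℤ :=
  Matrix.diagonal ![-1, 1, -1]

/-- The shift `(½, 0, ½)` of the half-turn. -/
def halfTurnShift : UnitAddTorus (Fin 3) :=
  fun i => if i = 1 then 0 else (((1 / 2 : ℝ)) : UnitAddCircle)

/-- The half-turn `H x = (½ − x₀, x₁, ½ − x₂)`: rotation by `π` about the line `{x₀ = ¼, x₂ = ¼}` through the
cell centre `J = (¼,¼,¼)`; `f_TG ∘ H = diag(−1,1,−1) · f_TG` (checked symbolically in TRIAGE-r1-1 (V) for the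
sibling card and numerically in this session's kit job). -/
def halfTurn (x : UnitAddTorus (Fin 3)) : UnitAddTorus (Fin 3) :=
  Torus.mulVecT halfTurnMat x + halfTurnShift

/-- `H`-symmetry of a vector field: `u (H x) = diag(−1,1,−1) · u x`.  In `Fix H` the vertical vorticity and
the vertical velocity vanish at the cell centre `J` (and on the whole horizontal line through it):
`ω₂(J) = u₂(J) = 0` — the obstruction that forced `Φ(p) = 0` ropes in round 1 (triage r1-2 N3). -/
def IsHSymm (u : UnitAddTorus (Fin 3) → EuclideanSpace ℝ (Fin 3)) : Prop :=
  ∀ x, u (halfTurn x) = actVec halfTurnMat (u x)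

/-! ## §3 Milestone M1: non-laminar (half-turn–broken) steady Taylor–Green states exist along `ν_j → 0⁺` -/

/-- **M1 (rigorous non-laminar existence).**  Along some `ν_j → 0⁺`, for every `j` and all large `N`, there is an
admissible Galerkin steady Taylor–Green state which is `K`-symmetric but NOT `H`-symmetric.  (The laminar
cell state has every symmetry of `f_TG`, so such a state is off the laminar branch.)  Obtained from
`TwistedDegreeForcesBrokenZeros` + the spectral parity of the symmetric branch (card, K2). -/
def HBrokenSteadyStatesExist : Prop :=
  ∃ ν : ℕ → ℝ, (∀ j, 0 < ν j) ∧ Tendsto ν atTop (𝓝 0) ∧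
    ∀ j, ∀ᶠ N in atTop, ∃ U : UnitAddTorus (Fin 3) → EuclideanSpace ℝ (Fin 3),
      IsSteadyState (ν j) N tgForce U ∧ IsKSymm U ∧ ¬ IsHSymm U

/-- **The census hypothesis (TG instantiation of the lever), abstract coordinates.**  Along `ν`, for every `j` and all large `N`
there are: a Euclidean coordinate space `ℝⁿ` (the `K ∩ C₄`-symmetric admissible Galerkin states at resolution `N`), the steady
Galerkin map `F` in these coordinates with the half-turn `H` acting linearly, the finite set `S` of `H`-symmetric zeros — satisfying
the hypotheses of `TwistedDegreeForcesBrokenZeros` INCLUDING the parity clause `∑ sign det ≠ 1` — and a realisation map `e` sending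
zeros of `F` to `K`-symmetric admissible steady Taylor–Green states at `(ν j, N)` under which `H`-symmetry of the field forces `H c = c`.
This is the line's stub `LaminarHalfTurnParity` in honest (global-census) form; see the card, residual (5a). -/
def GalerkinParityCensus (ν : ℕ → ℝ) : Prop :=
  ∀ j, ∀ᶠ N in atTop, ∃ (n : ℕ) (F : EuclideanSpace ℝ (Fin n) → EuclideanSpace ℝ (Fin n))
    (H : EuclideanSpace ℝ (Fin n) →L[ℝ] EuclideanSpace ℝ (Fin n)) (S : Finset (EuclideanSpace ℝ (Fin n)))
    (e : EuclideanSpace ℝ (Fin n) → UnitAddTorus (Fin 3) → EuclideanSpace ℝ (Fin 3)),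
    (∀ c, H (H c) = c) ∧ ContDiff ℝ 1 F ∧
    (∃ R : ℝ, 0 < R ∧ ∀ c, R ≤ ‖c‖ → 0 < ⟪F c, c⟫_ℝ) ∧
    (∀ c, c ∈ S ↔ (F c = 0 ∧ H c = c)) ∧
    (∀ c ∈ S, (fderiv ℝ F c).det ≠ 0) ∧
    (∑ c ∈ S, Real.sign ((fderiv ℝ F c).det)) ≠ 1 ∧
    (∀ c, F c = 0 → IsSteadyState (ν j) N tgForce (e c) ∧ IsKSymm (e c) ∧ (IsHSymm (e c) → H c = c))

/-- **Lever + census ⇒ M1** (kernel-checked composition: the abstract degree fact and the TG parity census give non-laminar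
`H`-broken steady Taylor–Green Galerkin states along `ν`). -/
theorem hBroken_of_census (hlever : TwistedDegreeForcesBrokenZeros) {ν : ℕ → ℝ} (hν : ∀ j, 0 < ν j)
    (hlim : Tendsto ν atTop (𝓝 0)) (hcensus : GalerkinParityCensus ν) : HBrokenSteadyStatesExist := by
  refine ⟨ν, hν, hlim, fun j => ?_⟩
  filter_upwards [hcensus j] with N hN
  obtain ⟨n, F, H, S, e, hHH, hF, hco, hS, hnd, hpar, hreal⟩ := hN
  obtain ⟨c, hc0, hcH⟩ := hlever n F H S hHH hF hco hS hnd hpar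
  obtain ⟨hst, hK, hHsym⟩ := hreal c hc0
  exact ⟨e c, hst, hK, fun h => hcH (hHsym h)⟩

/-! ## §4 The heart and the glue to the crux -/

/-- **Heart of the line.**  The log crux witnessed INSIDE the `H`-broken `K`-symmetric class (the through-flow
column states of the card): log energy, `ν`-independent loudness. -/
def HBrokenLogLoudStates : Prop :=
  ∃ (ν : ℕ → ℝ) (E c : ℝ), (∀ j, 0 < ν j ∧ ν j ≤ 1 / 4) ∧ Tendsto ν atTop (𝓝 0) ∧ 0 < c ∧
    ∀ j, ∀ᶠ N in atTop, ∃ U : UnitAddTorus (Fin 3) → EuclideanSpace ℝ (Fin 3),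
      IsSteadyState (ν j) N tgForce U ∧ IsKSymm U ∧ ¬ IsHSymm U ∧
        ∫ x, ‖U x‖ ^ 2 ≤ E * Real.log (1 / ν j) ∧ c ≤ ν j * gradNormSq U

/-- The heart implies the crux BY NAME (drop the two symmetry conjuncts; `tgForce` is the crux's lambda). -/
theorem crux_of_hBrokenLogLoud (h : HBrokenLogLoudStates) :
    Summit.AnomalousDissipation.AnomalousDissipation.Theses.MirrorVariety.TaylorGreenLogLoudStates := by
  obtain ⟨ν, E, c, hν, hlim, hc, hj⟩ := h
  intro f hf
  subst hf
  refine ⟨ν, E, c, hν, hlim, hc, fun j => ?_⟩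
  filter_upwards [hj j] with N hN
  obtain ⟨U, hU, -, -, hE, hl⟩ := hN
  exact ⟨U, hU, hE, hl⟩

/-- M1 is implied by the heart (sanity: the milestone sits below the heart). -/
theorem hBrokenSteadyStatesExist_of_heart (h : HBrokenLogLoudStates) : HBrokenSteadyStatesExist := by
  obtain ⟨ν, E, c, hν, hlim, -, hj⟩ := h
  refine ⟨ν, fun j => (hν j).1, hlim, fun j => ?_⟩
  filter_upwards [hj j] with N hN
  obtain ⟨U, hU, hK, hH, -, -⟩ := hN
  exact ⟨U, hU, hK, hH⟩

end Summit.AnomalousDissipation.AnomalousDissipation.Cruxes.TaylorGreenLogLoudStates.HalfTurnParity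

end
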